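import Summits.BirchSwinnertonDyer.Rank1Residual.F1Sign2.LevelZeroSpinLawNegDiscAtTwo
import HarnessLib

/-!
# DESC-40 kernel — -desc g30's sanity examples (Sketch40, VERBATIM) + REF1-AUDIT §259's probes for `F1Sign2/LevelZeroSpinLawNegDiscAtTwo.lean` (typer -ty g20)

CONTENT (all PROVED, no `sorry`, no new `def`): -desc's three `example`s (`HenselDatumAt 3 (X³ − X) 0 0`, `HenselDatumAt 3 (X³ − 9X) 0 2`, `QuadUnramifiedAt (−3) 2`); REF1 §259
probes (`REF1-data/b259/Probe259.lean` 0b936ec0a8f94c56) named as theorems: `henselDatumAt_five_cube_sub_25X` (`m = 2` datum), `not_henselDatumAt_three_cube_sub_X_one`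
(polarity: the middle conjunct pins `m`), `henselDatumAt_three_cube_sub_X_sub_three` (simple-root datum), `not_isAdicSquare_two_three` (`2` is not a 3-adic square, first
level), `false_of_placeOver_three_five` (`placeOver_unique` in use).  BSD is not proved by this; 23715 is not closed by this.
-/

noncomputable section

open scoped Classical

open WeierstrassCurve Literature.NumberTheory.EllipticCurves Literature.NumberTheory.DiophantineGeometry Polynomial IsDedekindDomain NumberField

namespace Summit.BirchSwinnertonDyer.Rank1Residual.F1Sign2.LevelZeroSpinLawNegDisc.Kernel

/-! ### -desc g30 sanity examples (Sketch40, VERBATIM) -/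

/-- `F = X³ − X` (roots `0, ±1`), `ℓ = 3`, `e = 0`: `F′(0) = −1` has `v₃ = 0` and `F(0) = 0`: a Hensel datum with `m = 0`. -/
example : HenselDatumAt 3 (X ^ 3 - X) 0 0 := by
  refine ⟨?_, ?_, ?_⟩
  · simp
  · simp
  · simp

/-- `F = X³ − 9X` (roots `0, ±3`), `ℓ = 3`, `e = 0`: `F′(0) = −9`, `v₃ = 2`, `F(0) = 0`: a Hensel datum with `m = 2` (EVEN: the 𝔯-valuation above the root `0`). -/
example : HenselDatumAt 3 (X ^ 3 - C 9 * X) 0 2 := by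
  refine ⟨?_, ?_, ?_⟩
  · simp
  · simp
  · simp

/-- `−3 = 4⁰·(−3)`, `−3 ≡ 1 (mod 4)`: `ℚ₂(√−3)` is the unramified quadratic field (verbatim from Sketch39). -/
example : QuadUnramifiedAt (-3) 2 := by
  refine ⟨?_, fun _ => ⟨0, -3, by norm_num, by decide⟩⟩
  have : padicValInt 2 (-3) = 0 := by
    rw [padicValInt]; simp
  rw [this]; exact ⟨0, rfl⟩

/-! ### REF1-AUDIT §259 probes (`REF1-data/b259/Probe259.lean` 0b936ec0a8f94c56, namespace `REF1_259`; REF1's `example`s named as theorems by the typer, statements and proofs VERBATIM) -/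

/-- `F = X³ − 25X` (roots `0, ±5`), `ℓ = 5`, `e = 0`: `F′(0) = −25`, `v₅ = 2`: Hensel datum with `m = 2`. -/
theorem henselDatumAt_five_cube_sub_25X : HenselDatumAt 5 (X ^ 3 - C 25 * X) 0 2 := by
  refine ⟨?_, ?_, ?_⟩
  · simp
  · simp
  · simp

/-- polarity: `m` is pinned by the middle conjunct — `X³ − X` at `ℓ = 3`, `e = 0` is NOT a Hensel datum with `m = 1` (`F′(0) = −1`). -/
theorem not_henselDatumAt_three_cube_sub_X_one : ¬ HenselDatumAt 3 (X ^ 3 - X) 0 1 := by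
  rintro ⟨h1, -, -⟩
  simp at h1

/-- `X³ − X − 3` at `ℓ = 3`, `e = 0`, `m = 0`: `F′(0) = −1` is a unit and `3¹ ∣ F(0) = −3`: the simple-root (`m = 0`) Hensel datum. -/
theorem henselDatumAt_three_cube_sub_X_sub_three : HenselDatumAt 3 (X ^ 3 - X - C 3) 0 0 := by
  refine ⟨?_, ?_, ?_⟩
  · simp
  · simp
  · simp

/-- `2` is not a square mod `3`, hence not a `3`-adic square (first level already fails). -/
theorem not_isAdicSquare_two_three : ¬ IsAdicSquare 2 3 := by
  intro h
  obtain ⟨x, hx⟩ := h 1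
  have hx' : x ^ 2 = 2 := by exact_mod_cast hx
  have key : ∀ y : ZMod (3 ^ 1), y ^ 2 ≠ 2 := by decide
  exact key x hx'

/-- `placeOver_unique` in use: a place cannot lie over two different primes. -/
theorem false_of_placeOver_three_five {v : HeightOneSpectrum (𝓞 ℚ)} (h : PlaceOver v 3) (h' : PlaceOver v 5) : False := by
  have := placeOver_unique h h'
  omega

end Summit.BirchSwinnertonDyer.Rank1Residual.F1Sign2.LevelZeroSpinLawNegDisc.Kernel

end
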